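import Summits.QuantumFields.YangMills.Theorems.AllWindowsColdBoxBoxHighLineK3PrimeRowEvenRemainders
import Summits.QuantumFields.YangMills.Theorems.AllWindowsColdBoxBoxHighLineGhostTaylorEven
import Summits.QuantumFields.YangMills.Theorems.AllWindowsColdBoxBoxHighLineEdgeChartParity
import Summits.QuantumFields.YangMills.Theorems.AllWindowsColdBoxBoxHighLinePlaqCostMomentsOnD

/-!
# U5 K3′ — row RA ASSEMBLED: the even tilt remainder slot `κ₃,₀^{μ_D}(L_x, L_y; Uᵉ − (ghost₂ + Haar₂ + Vr))` in the per-row `hKk` currency, for the vertex of record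
# `Vr := −W4 − β·phiQuartic` (planner ym-idea-2 g19 board 2026-08-30T02:10:18Z «hRA ← w4»; row-sum of record = fcl-p3 g27's ✓`tiltCum3_cutSet_size_of_rows … (hRA) …`;
# LINE-20 U5 ⟨stmt-QuantumFields-24336⟩ — U5 prep, helper-grade)

Extra width seat `ym-line-sfw-p2-w4` (g30).  The hypothesis `hRA` of fcl-p3 g27's hK3 row-sum ✓`tiltCum3_cutSet_size_of_rows (Vr) (mVr) (bVr) (hE1r) (hRA) …` reads, for the
generic polynomial even vertex `Vr β H`,
`|κ₃,₀^{μ_D}(L_x, L_y; (U + U∘neg)/2 − (quadVal ghostM + quadVal(−(1/3)·1) + Vr β H))| ≤ K β H` on every admissible symmetric cut set, plus the budget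
`β²H⁸·K → 0`.  With the vertex of record `Vr β H a := −W4 β H a − β·phiQuartic H a` (`W4` = ANY measurable polynomial part of `quarticWilson` with
`|quarticWilson − W4| ≤ C_R·β·H⁴·s⁶` on small fields — w3 g42's ✓`WilsonTaylor.exists_quarticTensor_quarticWilson` gives the `Q` of record, `C_R = 81920`) the slot is,
by parity (✓`cubicVertex_neg`, ✓`quarticWilson_neg`, ✓`divLinSq_neg`, ✓`haarLogRatio_neg`, ✓`phiTaylor` clause 1),
`Re = −(quarticWilson − W4) − β·(Φ∘chart − divLinSq − phiQuartic) + ((g + g∘neg)/2 − quadVal ghostM) + (haarLogRatio − quadVal(−(1/3)·1))`,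
whose sup on `D ⊆ smallField H s` is `ν = C_R·β·H⁴s⁶ + C_Φ·β·H⁴s⁶ + C_g·H⁸(1+log H)^m s⁴ + C_h·H⁴s⁴` (the four ν-suppliers: `hW4`, ✓`abs_phiRem_le_of_mem_smallField`,
LEAD g78's ✓`ghostTaylorEven` at `t := s` (`s·H² ≤ c₀` by ✓`side_budget`), ✓`abs_haarRem_le_of_mem_smallField`), and ONE application of the generic sup×L² row
✓`abs_tiltCum3_muSet_linCurvSq_linCurvSq_le_of_sup` gives

* ★★ `GaussRestrict.rowBound_RA (W4) (mW4) (CR) (hCR) (hW4) : <fcl-p3's hRA VERBATIM at Vr β H a := −W4 β H a − β·phiQuartic H a>` — `q := 0`,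
  `K β H := C·ν·(1+log H)²/β²`; budget rows at `κ₃ = 1/8 − θ/4`: `H¹²L²s⁶β` (×2) **`21θ/2 < 5/4`**, `H¹⁶L^{m+2}s⁴` **`15θ < 3/2`** (strict exactly on `θ < 1/10`),
  `H¹²L²s⁴` **`11θ < 3/2`** — all ✓ for every `θ < 1/10`.

No definitions; tree only; standard axioms.  HONEST LABEL: helper-grade assembly of ONE row of the open size hypothesis `hK3` of the CONDITIONAL U5 bookkeeping;
`hK3`, U5 `stub_landauThirdOrder`, ⟨24336⟩, ⟨24004⟩ and this seat's crux ⟨stmt-QuantumFields-22884⟩ remain OPEN; route AllWindowsColdBox is DRAFT; no crux, rung or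
summit is proved; **the Yang–Mills mass gap is NOT proved by this file; no summit is proved by a line.**
-/

set_option autoImplicit false

noncomputable section

open MeasureTheory Set
open Literature.Probability.LatticeModels (Site)
open Summit.QuantumFields.YangMills.Theorems.WeakCouplingRates (plaq12At)

namespace Summit.QuantumFields.YangMills.Theorems.AllWindowsColdBoxBoxHighLine

namespace GaussRestrict

open AssemblyBudget ErrorBudget

/-- ★★ **Row RA of the hK3 row-sum, ASSEMBLED, in the per-row `hKk` currency** (see the module docstring): for the vertex of record
`Vr β H a := −W4 β H a − β·phiQuartic H a`, any measurable polynomial part `W4` of `quarticWilson` with a sextic sup remainder on small fields. -/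
theorem rowBound_RA (W4 : ℝ → (H : ℕ) → (LandauFree H → E3) → ℝ) (mW4 : ∀ (β : ℝ) (H : ℕ), Measurable (W4 β H)) (CR : ℝ) (hCR : 0 ≤ CR)
    (hW4 : ∀ H : ℕ, 1 ≤ H → ∀ β : ℝ, 0 < β → ∀ s : ℝ, 0 ≤ s → s ≤ 1 → ∀ a ∈ smallField H s,
      |quarticWilson β H a - W4 β H a| ≤ CR * β * (H : ℝ) ^ 4 * s ^ 6) :
    ∀ θ : ℝ, 0 < θ → θ < 1 / 10 → ∃ q : ℝ, ∃ K : ℝ → ℕ → ℝ,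
      (∃ β₀ : ℝ, 1 ≤ β₀ ∧ ∀ β : ℝ, β₀ ≤ β → ∀ H : ℕ, 1 ≤ H → β ^ θ ≤ (H : ℝ) → (H : ℝ) ≤ β ^ θ + 1 →
        ∀ D : Set (LandauFree H → E3), MeasurableSet D → D ⊆ smallField H (β ^ ((1 / 8 - θ / 4) - 1 / 2)) → (∀ a, -a ∈ D ↔ a ∈ D) →
        gaussAvg β H (fun a => 1 - D.indicator (fun _ => (1 : ℝ)) a) ≤ β ^ (-q) →
        gaussAvg β H (fun a => 1 - D.indicator (fun _ => (1 : ℝ)) a) ≤ 1 / 2 → (∀ a ∈ D, |tiltU β H a| ≤ 2) → ∀ x y : Site 4,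
        |Tilt.tiltCum3 (((volume : Measure (LandauFree H → E3)).restrict D).withDensity fun a => ENNReal.ofReal (gaussWeight β H a))
            (fun a => (tiltU β H a + tiltU β H (-a)) / 2 -
              (quadVal (GhostFP.ghostM H) a + quadVal ((-(1 / 3 : ℝ)) • (1 : Matrix (LandauFree H × Fin 3) (LandauFree H × Fin 3) ℝ)) a +
                (-W4 β H a - β * phiQuartic H a))) 0
            (linCurvSq H (plaq12At x)) (linCurvSq H (plaq12At y))| ≤ K β H) ∧
      (∀ ε : ℝ, 0 < ε → ∃ β₀ : ℝ, 1 ≤ β₀ ∧ ∀ β : ℝ, β₀ ≤ β → ∀ H : ℕ, 1 ≤ H → (H : ℝ) ≤ β ^ θ + 1 → β ^ 2 * (H : ℝ) ^ 8 * K β H ≤ ε) := by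
  intro θ hθ hθ'
  obtain ⟨C, hC0, hrow⟩ := abs_tiltCum3_muSet_linCurvSq_linCurvSq_le_of_sup
  obtain ⟨CΦ, hCΦ, hΦ⟩ := abs_phiRem_le_of_mem_smallField
  obtain ⟨Ch, hCh, hh⟩ := abs_haarRem_le_of_mem_smallField
  obtain ⟨Cg₀, c₀, m, hc₀, hg₀⟩ := ghostTaylorEven
  obtain ⟨CP, hP⟩ := phiTaylor
  -- a nonnegative ghost constant
  set Cg : ℝ := max Cg₀ 0 with hCgdef
  have hCg : 0 ≤ Cg := le_max_right _ _
  have hg : ∀ H : ℕ, 1 ≤ H → ∀ (t : ℝ) (a : LandauFree H → E3), 0 ≤ t → t * (H : ℝ) ^ 2 ≤ c₀ → (∀ e, ‖a e‖ ≤ t) →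
      |(ghostLogRatio H a + ghostLogRatio H (-a)) / 2 - quadVal (GhostFP.ghostM H) a| ≤ Cg * (H : ℝ) ^ 8 * (1 + Real.log H) ^ m * t ^ 4 := by
    intro H hH t a ht htH hat
    refine (hg₀ H hH t a ht htH hat).trans ?_
    have hH1 : (1 : ℝ) ≤ H := by exact_mod_cast hH
    have hL0 : 0 ≤ 1 + Real.log (H : ℝ) := by have := Real.log_nonneg hH1; linarith
    exact mul_le_mul_of_nonneg_right (mul_le_mul_of_nonneg_right (mul_le_mul_of_nonneg_right (le_max_left _ _) (by positivity)) (by positivity))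
      (by positivity)
  obtain ⟨b₀, hb₀, hside⟩ := side_budget (κ₃ := 1 / 8 - θ / 4) (c := c₀) hθ (by linarith) (by linarith) hc₀ 0
  refine ⟨0, fun β H => C * (CR * β * (H : ℝ) ^ 4 * (β ^ ((1 / 8 - θ / 4) - 1 / 2)) ^ 6 + CΦ * β * (H : ℝ) ^ 4 * (β ^ ((1 / 8 - θ / 4) - 1 / 2)) ^ 6 +
      Cg * (H : ℝ) ^ 8 * (1 + Real.log H) ^ m * (β ^ ((1 / 8 - θ / 4) - 1 / 2)) ^ 4 + Ch * (H : ℝ) ^ 4 * (β ^ ((1 / 8 - θ / 4) - 1 / 2)) ^ 4) *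
      (1 + Real.log H) ^ 2 / β ^ 2, ⟨b₀, hb₀, ?_⟩, ?_⟩
  · intro β hβ H hH hHl hHu D hDm hDs hsym _ hco2 hU x y
    obtain ⟨-, hsH, -, -, hs1⟩ := hside β hβ H hH hHl hHu
    have hβ0 : 0 < β := by linarith
    set s : ℝ := β ^ ((1 / 8 - θ / 4) - 1 / 2) with hs
    have hs0 : 0 ≤ s := Real.rpow_nonneg hβ0.le _
    have hH1 : (1 : ℝ) ≤ H := by exact_mod_cast hH
    have hL0 : 0 ≤ 1 + Real.log (H : ℝ) := by have := Real.log_nonneg hH1; linarith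
    -- measurability of the slot
    have mRe : Measurable fun a : LandauFree H → E3 => (tiltU β H a + tiltU β H (-a)) / 2 -
        (quadVal (GhostFP.ghostM H) a + quadVal ((-(1 / 3 : ℝ)) • (1 : Matrix (LandauFree H × Fin 3) (LandauFree H × Fin 3) ℝ)) a +
          (-W4 β H a - β * phiQuartic H a)) :=
      (((GaussNormalForm.measurable_tiltU β H).add ((GaussNormalForm.measurable_tiltU β H).comp measurable_neg)).div_const 2).sub
        (((measurable_quadVal _).add (measurable_quadVal _)).add ((mW4 β H).neg.sub ((PhiQuartic.measurable_phiQuartic H).const_mul β)))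
    -- the sup of the slot on `D`: four pieces
    have hν0 : 0 ≤ CR * β * (H : ℝ) ^ 4 * s ^ 6 + CΦ * β * (H : ℝ) ^ 4 * s ^ 6 + Cg * (H : ℝ) ^ 8 * (1 + Real.log H) ^ m * s ^ 4 + Ch * (H : ℝ) ^ 4 * s ^ 4 := by
      positivity
    have bRe : ∀ a ∈ D, |(tiltU β H a + tiltU β H (-a)) / 2 -
        (quadVal (GhostFP.ghostM H) a + quadVal ((-(1 / 3 : ℝ)) • (1 : Matrix (LandauFree H × Fin 3) (LandauFree H × Fin 3) ℝ)) a +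
          (-W4 β H a - β * phiQuartic H a))| ≤
        CR * β * (H : ℝ) ^ 4 * s ^ 6 + CΦ * β * (H : ℝ) ^ 4 * s ^ 6 + Cg * (H : ℝ) ^ 8 * (1 + Real.log H) ^ m * s ^ 4 + Ch * (H : ℝ) ^ 4 * s ^ 4 := by
      intro a ha
      have has : a ∈ smallField H s := hDs ha
      have hev : landauPhi H (edgeChart H (-a)) = landauPhi H (edgeChart H a) := (hP H hH a).1
      have hid : (tiltU β H a + tiltU β H (-a)) / 2 -
          (quadVal (GhostFP.ghostM H) a + quadVal ((-(1 / 3 : ℝ)) • (1 : Matrix (LandauFree H × Fin 3) (LandauFree H × Fin 3) ℝ)) a +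
            (-W4 β H a - β * phiQuartic H a)) =
          -(quarticWilson β H a - W4 β H a) + -(β * (landauPhi H (edgeChart H a) - divLinSq H a - phiQuartic H a)) +
            ((ghostLogRatio H a + ghostLogRatio H (-a)) / 2 - quadVal (GhostFP.ghostM H) a) +
            (haarLogRatio H a - quadVal ((-(1 / 3 : ℝ)) • (1 : Matrix (LandauFree H × Fin 3) (LandauFree H × Fin 3) ℝ)) a) := by
        simp only [tiltU]
        rw [EdgeChartGaussian.cubicVertex_neg, EdgeChartGaussian.quarticWilson_neg, hev, EdgeChartGaussian.divLinSq_neg, TiltSup.haarLogRatio_neg]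
        ring
      rw [hid]
      have h1 : |-(quarticWilson β H a - W4 β H a)| ≤ CR * β * (H : ℝ) ^ 4 * s ^ 6 := by
        rw [abs_neg]; exact hW4 H hH β hβ0 s hs0 hs1 a has
      have h2 : |-(β * (landauPhi H (edgeChart H a) - divLinSq H a - phiQuartic H a))| ≤ CΦ * β * (H : ℝ) ^ 4 * s ^ 6 := by
        rw [abs_neg, abs_mul, abs_of_pos hβ0]
        calc β * |landauPhi H (edgeChart H a) - divLinSq H a - phiQuartic H a| ≤ β * (CΦ * (H : ℝ) ^ 4 * s ^ 6) :=
              mul_le_mul_of_nonneg_left (hΦ H hH s hs0 hs1 a has) hβ0.le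
          _ = CΦ * β * (H : ℝ) ^ 4 * s ^ 6 := by ring
      have h3 : |(ghostLogRatio H a + ghostLogRatio H (-a)) / 2 - quadVal (GhostFP.ghostM H) a| ≤ Cg * (H : ℝ) ^ 8 * (1 + Real.log H) ^ m * s ^ 4 :=
        hg H hH s a hs0 hsH fun e => has e
      have h4 := hh H hH s hs0 hs1 a has
      calc |-(quarticWilson β H a - W4 β H a) + -(β * (landauPhi H (edgeChart H a) - divLinSq H a - phiQuartic H a)) +
            ((ghostLogRatio H a + ghostLogRatio H (-a)) / 2 - quadVal (GhostFP.ghostM H) a) +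
            (haarLogRatio H a - quadVal ((-(1 / 3 : ℝ)) • (1 : Matrix (LandauFree H × Fin 3) (LandauFree H × Fin 3) ℝ)) a)|
          ≤ |-(quarticWilson β H a - W4 β H a)| + |-(β * (landauPhi H (edgeChart H a) - divLinSq H a - phiQuartic H a))| +
            |(ghostLogRatio H a + ghostLogRatio H (-a)) / 2 - quadVal (GhostFP.ghostM H) a| +
            |haarLogRatio H a - quadVal ((-(1 / 3 : ℝ)) • (1 : Matrix (LandauFree H × Fin 3) (LandauFree H × Fin 3) ℝ)) a| := by
            refine (abs_add_le _ _).trans (add_le_add ((abs_add_le _ _).trans (add_le_add (abs_add_le _ _) le_rfl)) le_rfl)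
        _ ≤ _ := add_le_add (add_le_add (add_le_add h1 h2) h3) h4
    exact hrow H hH β hβ0 s hs0 D hDm hDs (1 / 2) hco2 le_rfl _ mRe _ hν0 bRe x y
  · intro ε hε
    have hε' : 0 < ε / 4 := by positivity
    obtain m₁ := budget_monomial (a := 1) (k := 12) (j := 6) (κ₃ := 1 / 8 - θ / 4) hθ.le (by push_cast; linarith) hε' (C * CR) 2
    obtain m₂ := budget_monomial (a := 1) (k := 12) (j := 6) (κ₃ := 1 / 8 - θ / 4) hθ.le (by push_cast; linarith) hε' (C * CΦ) 2
    obtain m₃ := budget_monomial (a := 0) (k := 16) (j := 4) (κ₃ := 1 / 8 - θ / 4) hθ.le (by push_cast; linarith) hε' (C * Cg) (m + 2)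
    obtain m₄ := budget_monomial (a := 0) (k := 12) (j := 4) (κ₃ := 1 / 8 - θ / 4) hθ.le (by push_cast; linarith) hε' (C * Ch) 2
    obtain ⟨β₀, hβ₀, hall⟩ := exists_forall_and m₁ (exists_forall_and m₂ (exists_forall_and m₃ m₄))
    refine ⟨β₀, hβ₀, fun β hβ H hH hHu => ?_⟩
    obtain ⟨e₁, e₂, e₃, e₄⟩ := hall β hβ H
    replace e₁ := e₁ hH hHu
    replace e₂ := e₂ hH hHu
    replace e₃ := e₃ hH hHu
    replace e₄ := e₄ hH hHu
    have hβ0 : 0 < β := by linarith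
    simp only [Real.rpow_one] at e₁ e₂
    simp only [Real.rpow_zero, mul_one] at e₃ e₄
    set s : ℝ := β ^ ((1 / 8 - θ / 4) - 1 / 2) with hs
    have hid : β ^ 2 * (H : ℝ) ^ 8 * (C * (CR * β * (H : ℝ) ^ 4 * s ^ 6 + CΦ * β * (H : ℝ) ^ 4 * s ^ 6 +
        Cg * (H : ℝ) ^ 8 * (1 + Real.log H) ^ m * s ^ 4 + Ch * (H : ℝ) ^ 4 * s ^ 4) * (1 + Real.log H) ^ 2 / β ^ 2) =
        C * CR * (H : ℝ) ^ 12 * (1 + Real.log H) ^ 2 * s ^ 6 * β + C * CΦ * (H : ℝ) ^ 12 * (1 + Real.log H) ^ 2 * s ^ 6 * β +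
          C * Cg * (H : ℝ) ^ 16 * (1 + Real.log H) ^ (m + 2) * s ^ 4 + C * Ch * (H : ℝ) ^ 12 * (1 + Real.log H) ^ 2 * s ^ 4 := by
      field_simp
      ring
    rw [hid]
    linarith

end GaussRestrict

end Summit.QuantumFields.YangMills.Theorems.AllWindowsColdBoxBoxHighLine
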